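import Literature.Barriers.Parity.SiegelZeroPrimePairs
import HarnessLib

/-!
# A sparse two-sided Goldbach bound on the multiples of the conductor excludes a real zero near 1
# (Bhowmik–Grimmelt 2026, Theorem 8.2 — PREPRINT, unrefereed)

Topic `Literature/NumberTheory/LFunctions` (namespace `Literature.NumberTheory.LFunctions`, paper
vocabulary in `BhowmikGrimmelt2026`). Typed for the cell `landau-siegel` (LANDAU–SIEGEL PROGRAMME,
rung F-S3, §C literature harvest, reader r6, row r6-T06), statement-first (D-0014/D-0064): ONE named
CLAIM (D-0012: the source is the arXiv preprint arXiv:2607.27282v2 of 13 Aug 2026, not refereed;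
tagged `[claim: BhowmikGrimmelt2026, status: under-review]`), its hypothesis as a PREDICATE in the
vocabulary of the tree's Goldston–Suriajaya file (`Literature.Barriers.Parity.WeakHLGoldbachConj`,
`Literature.NumberTheory.Sieve.goldbachLambdaCount` = `r₂(N) = ψ₂(N)`,
`Literature.NumberTheory.Sieve.goldbachSingularSeries` = `𝔖(N)`), and PROVED bookkeeping: the
dense hypothesis (Goldston–Suriajaya's (5), all large even `n`) implies the sparse one with NO
exceptions, whence — modulo the claim — a zero-free real segment `(1 − c(δ)/(A log r̃), ∞)` for
every primitive real character of large conductor `r̃`.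

Context in the tree: the dense version is PROVED — `Literature.Barriers.Parity.GoldstonSuriajaya2021_goldbach_holds`
(`WeakHLGoldbachConj δ` ⇒ `β₁ < 1 − C(δ)/log² q`); Matomäki–Merikoski's Corollary 1.2 (ONE multiple
`h ≡ 0 (mod q)`, `h ∈ [q^{10}, q^{η^{99/100}}]`) is the named fact
`Literature.Barriers.Parity.matomakiMerikoski2023_corollary12` (`SiegelZeroPrimePairsNarrow.lean`, whose
docstring already quotes Theorem 8.2 for the robustness of the barrier); the one-sided sparse LOWER
bound version for odd characters is `Literature.NumberTheory.LFunctions.bhowmikHalupczok2021_theorem11`.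
The present statement sits between them: two-sided, at ONE scale `X = r̃^A` (`A > 5/2`), only on
the even multiples of `r̃` in `[X/2, X]` (`≍ X^{1−1/A}` numbers), and allowed to fail on a
power-sized set of `≤ X^{3/5}` of them. The authors' own comparison (§8, p. 30): "This approach does
fall short of the more recent result of Matomäki–Merikoski [16, Cor. 1.2], who need only a single
multiple `N` of the conductor … However, since their hypothesis lives at the scale `N ≥ r̃^{10}`,
while ours operates at `N ≍ r̃^A` for any fixed `A > 5/2`, their statement does not imply ours."

## What the source prints (fetched text `paper:arxiv-2607.27282`, pp. 4, 7, 30–32, read 2026-08-26)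

G. Bhowmik, L. Grimmelt, *The exceptional set of the Goldbach problem*, arXiv:2607.27282v2.
p. 4: "`r₂(N) := Σ_{n₁+n₂=N} Λ(n₁)Λ(n₂)`". p. 7, Conjecture 2.1 (Hardy–Littlewood): "For even
integers `N → ∞`, one has `r₂(N) ∼ 𝔖(N)N`." p. 30 (§8): "`χ̃` denotes a primitive real character of
conductor `r̃` whose `L`-function has a real zero `β̃ = 1 − δ̃` near 1." **Theorem 8.2** (p. 31):
"Fix `A > 5/2` and `δ ∈ (0,1)`. There are `c = c(δ) > 0` and `r₀ = r₀(A, δ)` such that the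
following holds for every `r̃ ≥ r₀`. Let `X = r̃^A` and assume that
(8.4) `δ𝔖(N)N ≤ r₂(N) ≤ (2−δ)𝔖(N)N` holds for all but at most `X^{3/5}` even `N ∈ [X/2, X]` with
`r̃ ∣ N`, then no `L(s, χ̃)` with `χ̃` a primitive real character modulo `r̃` has a real zero
`β̃ > 1 − c/log X`." (Proof, pp. 31–32: Pintz's explicit formula for the major arcs with the
exceptional zero kept, the Deuring–Heilbronn repulsion, Vinogradov's minor-arc bound; "The exponent
`3/5`, and with it the restriction `ϑ ≥ 2/5`, is forced by Vinogradov's minor-arc bound".)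

## Lean rendering / design choices

* `r₂(N)` = `goldbachLambdaCount N`, `𝔖(N)` = `goldbachSingularSeries N` (as in the tree's GS21
  file; (8.4) is literally Goldston–Suriajaya's (5) at `N`). The exceptional set at scale `X` for
  the modulus `r` is the finset `BhowmikGrimmelt2026.exceptions δ X r` of even multiples `N` of `r`
  with `X/2 ≤ N ≤ X` violating (8.4); the hypothesis is `#exceptions ≤ X^{3/5}` with `X = r^A`
  (real power `Real.rpow`).
* Constants: print has `c = c(δ)` (independent of `A`) and `r₀ = r₀(A, δ)`; rendered in that
  order, `∀ δ ∈ (0,1), ∃ c > 0, ∀ A > 5/2, ∃ r₀, ∀ r ≥ r₀`.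
* "no real zero `β̃ > 1 − c/log X`": `χ.LFunction β ≠ 0` for every real `β > 1 − c/log X`
  (for `β ≥ 1` this is classical and harmless). `χ̃` = any primitive quadratic Dirichlet character
  mod `r` (Mathlib `IsPrimitive`, `MulChar.IsQuadratic`).

PROVED here: `exceptions_eq_empty_of_weakHLGoldbach` (under `WeakHLGoldbachConj δ` the
exceptional sets are empty once `X/2 ≥ n₀`), and the corollary `zeroFree_of_weakHLGoldbach`
(claim + `WeakHLGoldbachConj δ` ⇒ for every `A > 5/2` and all large `r`, no real zero of a
primitive real `L(s,χ)` mod `r` in `(1 − c/(A log r), ∞)`) — a conclusion already implied, with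
`log⁻²`-strength only, by the proved GS21 theorem; recorded to make the comparison kernel-visible.
NOT typed: Theorem 1.2 / Proposition 8.1 / the Pintz machinery (that is r-scope «exceptional set
of Goldbach», not §C).

LABEL (cell rule): statement layer / literature harvest, tag «none» (additive exit). «The programme
SEARCHES and TYPES; no claim about Landau–Siegel zeros, Theorems 1–2 of arXiv:2211.02515 or a
repaired Margin232 until a kernel theorem says so.»

## References

* [BhowmikGrimmelt2026] G. Bhowmik, L. Grimmelt, arXiv:2607.27282v2 (2026), §2 (r₂, Conjecture 2.1),
  §8 Theorem 8.2 — PREPRINT, status under review.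
* [GoldstonSuriajaya2021] D. A. Goldston, A. I. Suriajaya, arXiv:2104.09407, (1), (5) — vocabulary.
* [MatomakiMerikoski2023] K. Matomäki, J. Merikoski, Corollary 1.2 — the single-multiple sibling.
-/

noncomputable section

open Finset Real

namespace Literature.NumberTheory.LFunctions

namespace BhowmikGrimmelt2026

open Literature.NumberTheory.Sieve Literature.Barriers.Parity

/-- **(8.4) at `N`**: `δ𝔖(N)N ≤ r₂(N) ≤ (2 − δ)𝔖(N)N` (Goldston–Suriajaya's (5) at `N`).
[cite: GoldstonSuriajaya2021, §1 (5)] [claim: BhowmikGrimmelt2026, status: under-review] -/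
def TwoSidedAt (δ : ℝ) (N : ℕ) : Prop :=
  δ * (goldbachSingularSeries N * N) ≤ goldbachLambdaCount N ∧
    goldbachLambdaCount N ≤ (2 - δ) * (goldbachSingularSeries N * N)

open Classical in
/-- The exceptional set of Theorem 8.2 at scale `X` for the modulus `r`: the even multiples `N` of
`r` with `X/2 ≤ N ≤ X` at which (8.4) fails. [claim: BhowmikGrimmelt2026, status: under-review] -/
def exceptions (δ X : ℝ) (r : ℕ) : Finset ℕ :=
  (Finset.range (⌊X⌋₊ + 1)).filter fun N ↦ X / 2 ≤ (N : ℝ) ∧ (N : ℝ) ≤ X ∧ Even N ∧ r ∣ N ∧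
    ¬ TwoSidedAt δ N

/-- **The sparse hypothesis of Theorem 8.2** for `(A, δ)` at the modulus `r`: with `X = r^A`, (8.4)
holds for all but at most `X^{3/5}` even `N ∈ [X/2, X]` with `r ∣ N`. A PREDICATE, consumed only
as an assumption, never asserted. [claim: BhowmikGrimmelt2026, status: under-review] -/
def SparseTwoSided (A δ : ℝ) (r : ℕ) : Prop :=
  ((exceptions δ ((r : ℝ) ^ A) r).card : ℝ) ≤ ((r : ℝ) ^ A) ^ ((3 : ℝ) / 5)

open Classical in
/-- Under Goldston–Suriajaya's dense hypothesis (5) (all even `n ≥ n₀`) the exceptional sets are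
empty as soon as `X/2 ≥ n₀`. [cite: GoldstonSuriajaya2021, §1 (5)] -/
theorem exceptions_eq_empty_of_weakHLGoldbach {δ : ℝ} (h : WeakHLGoldbachConj δ) :
    ∃ X₀ : ℝ, ∀ X : ℝ, X₀ ≤ X → ∀ r : ℕ, exceptions δ X r = ∅ := by
  obtain ⟨n₀, hn₀⟩ := h
  refine ⟨2 * n₀, fun X hX r ↦ ?_⟩
  rw [exceptions, Finset.filter_eq_empty_iff]
  intro N _ hN
  obtain ⟨hlo, -, heven, -, hbad⟩ := hN
  have hN0 : n₀ ≤ N := by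
    have : (n₀ : ℝ) ≤ N := by linarith
    exact_mod_cast this
  exact hbad (hn₀ N hN0 heven)

/-- Hence the dense hypothesis gives the sparse one for every `A > 0` and all large `r`.
[cite: GoldstonSuriajaya2021, §1 (5)] [claim: BhowmikGrimmelt2026, status: under-review] -/
theorem sparseTwoSided_of_weakHLGoldbach {δ : ℝ} (h : WeakHLGoldbachConj δ) {A : ℝ} (hA : 0 < A) :
    ∃ r₀ : ℕ, ∀ r : ℕ, r₀ ≤ r → SparseTwoSided A δ r := by
  obtain ⟨X₀, hX₀⟩ := exceptions_eq_empty_of_weakHLGoldbach h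
  -- choose `r₀` with `r₀ ^ A ≥ X₀`: `r ^ A → ∞`
  have htend : Filter.Tendsto (fun r : ℕ ↦ (r : ℝ) ^ A) Filter.atTop Filter.atTop :=
    (tendsto_rpow_atTop hA).comp tendsto_natCast_atTop_atTop
  obtain ⟨r₀, hr₀⟩ := Filter.eventually_atTop.1 (htend.eventually_ge_atTop X₀)
  refine ⟨r₀, fun r hr ↦ ?_⟩
  rw [SparseTwoSided, hX₀ _ (hr₀ r hr) r, Finset.card_empty, Nat.cast_zero]
  positivity

end BhowmikGrimmelt2026

open BhowmikGrimmelt2026 Literature.Barriers.Parity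

/-- **Bhowmik–Grimmelt 2026, Theorem 8.2 (NAMED CLAIM — arXiv preprint, unrefereed).** "Fix
`A > 5/2` and `δ ∈ (0,1)`. There are `c = c(δ) > 0` and `r₀ = r₀(A, δ)` such that the following
holds for every `r̃ ≥ r₀`. Let `X = r̃^A` and assume that (8.4) `δ𝔖(N)N ≤ r₂(N) ≤ (2−δ)𝔖(N)N` holds
for all but at most `X^{3/5}` even `N ∈ [X/2, X]` with `r̃ ∣ N`, then no `L(s, χ̃)` with `χ̃` a
primitive real character modulo `r̃` has a real zero `β̃ > 1 − c/log X`." Rendered: for every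
`δ ∈ (0,1)` there is `c > 0` such that for every `A > 5/2` there is `r₀` with: for all `r ≥ r₀`
satisfying `SparseTwoSided A δ r`, every primitive quadratic `χ` mod `r` and every real
`β > 1 − c/log (r^A)` have `L(β, χ) ≠ 0`. Status: claimed in an unrefereed preprint (proof sketched
from Pintz's explicit formula, §8); unproved here.
[claim: BhowmikGrimmelt2026, status: under-review] [cite: BhowmikGrimmelt2026, Theorem 8.2] -/
def bhowmikGrimmelt2026_theorem82 : Prop :=
  ∀ δ : ℝ, 0 < δ → δ < 1 → ∃ c : ℝ, 0 < c ∧ ∀ A : ℝ, 5 / 2 < A → ∃ r₀ : ℕ,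
    ∀ (r : ℕ) [NeZero r], r₀ ≤ r → SparseTwoSided A δ r →
      ∀ χ : DirichletCharacter ℂ r, χ.IsPrimitive → χ.IsQuadratic →
        ∀ β : ℝ, 1 - c / Real.log ((r : ℝ) ^ A) < β → χ.LFunction (β : ℂ) ≠ 0

/-- **Corollary (PROVED modulo the claim): the dense Goldston–Suriajaya hypothesis through the
sparse theorem.** If Theorem 8.2 holds and `WeakHLGoldbachConj δ` holds for some `δ ∈ (0,1)`, then
for every `A > 5/2` and all large `r`, no primitive real `L(s, χ)` mod `r` has a real zero in
`(1 − c(δ)/log(r^A), ∞)` — a zero-free real segment of length `≍ 1/log r`. (The tree's proved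
`GoldstonSuriajaya2021_goldbach_holds` gives `β₁ < 1 − C(δ)/log² q` from the same hypothesis by a
different route; this corollary only records what the sparse claim adds when fed the dense input.)
[claim: BhowmikGrimmelt2026, status: under-review] [cite: GoldstonSuriajaya2021, §1 (5)] -/
theorem zeroFree_of_weakHLGoldbach (h82 : bhowmikGrimmelt2026_theorem82) {δ : ℝ} (hδ : 0 < δ)
    (hδ1 : δ < 1) (hW : WeakHLGoldbachConj δ) :
    ∃ c : ℝ, 0 < c ∧ ∀ A : ℝ, 5 / 2 < A → ∃ r₀ : ℕ, ∀ (r : ℕ) [NeZero r], r₀ ≤ r →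
      ∀ χ : DirichletCharacter ℂ r, χ.IsPrimitive → χ.IsQuadratic →
        ∀ β : ℝ, 1 - c / Real.log ((r : ℝ) ^ A) < β → χ.LFunction (β : ℂ) ≠ 0 := by
  obtain ⟨c, hc, h⟩ := h82 δ hδ hδ1
  refine ⟨c, hc, fun A hA ↦ ?_⟩
  obtain ⟨r₀, hr₀⟩ := h A hA
  obtain ⟨r₁, hr₁⟩ := sparseTwoSided_of_weakHLGoldbach hW (show (0 : ℝ) < A by linarith)
  refine ⟨max r₀ r₁, fun r _ hr χ hprim hquad β hβ ↦ ?_⟩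
  exact hr₀ r (le_of_max_le_left hr) (hr₁ r (le_of_max_le_right hr)) χ hprim hquad β hβ

end Literature.NumberTheory.LFunctions

end
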